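import Summits.AtomisticToContinuum.HydrodynamicLimit.Theorems.BoxDissipativeWeakStrongFluxClosureEqKinStatic
import Summits.AtomisticToContinuum.HydrodynamicLimit.Theorems.BoxDissipativeWeakStrongFluxClosureKineticIsotropyTight
import Summits.AtomisticToContinuum.HydrodynamicLimit.Theorems.JParityClosureOddContactSymmetryGibbsInvariance
import Literature.Analysis.FluidPDE.HardSphereFlowJointMeasurable
import HarnessLib

/-!
# Kinetic isotropy in global equilibrium — rung 0 of stub K of crux `FluxClosure`
(route `BoxDissipativeWeakStrong`, item stmt-AtomisticToContinuum-9902, line `registered`)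

Support file of the lead prover (registered sub-goal `kineticIsotropy_homogeneous`, E7). The open stub
`stub_kineticIsotropy` (K) of the crux skeleton asserts that the space–time average against `∇w` of the
TRACELESS box velocity covariance `KinDev_N(z) = ∫_{(0,τ]} ∫ Σᵢⱼ (Sk − m̂⊗m̂/ρ̂ − δ ρ̂θ̂)ᵢⱼ ∂ⱼwᵢ dx dt` of the box
fields of `N + 1` deterministic hard spheres (cube kernel at a kinetic window `ℓ_N`, `(N+1)ℓ_N³ → ∞`) tends to `0`
in `L¹(P_N)` along the flow, for local Gibbs initial laws with arbitrary continuous profiles — the positive-time,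
flux-level local-equilibrium input for which no theorem is known. This file proves its GLOBAL-EQUILIBRIUM instance:
for CONSTANT profiles `a₀ ≡ a`, `u₀ ≡ u`, `θ₀ ≡ θ` (homogeneous Gibbs law), for EVERY hard-sphere flow family and
EVERY window with `(N+1)ℓ_N³ → ∞`, `∫⁻ |KinDev_N| dP_N → 0`, indeed `≤ τ · C_w · C(θ) · (((N+1)ℓ_N³)^{-1/2} + ((N+1)ℓ_N³)⁻¹)`.

Proof: `ofReal |∫_{(0,τ]} g| ≤ ∫⁻_{(0,τ]} ofReal |g|`; Tonelli on `P_N ⊗ dt` (the flow is jointly measurable on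
`good × ℝ`, `HardSphereFlow.measurable_flow_prod_torus`, and `P_N` is carried by the good set); at each fixed time
the homogeneous Gibbs law is INVARIANT under `Φ_t` (`measurePreserving_flow_localGibbsLaw_const`: Liouville +
conservation of energy and momentum), so the time-`t` expectation is a STATIC Gibbs expectation, bounded by the
Gaussian statics of the traceless box covariance (`FluxClosureEq.E6.kinStatic_lintegral_localGibbs_le`: velocities
given the positions are i.i.d. Maxwellian, the traceless second moment has mean zero and variance
`O(((N+1)ℓ³)⁻¹ ρ̂)`); integrate the `t`-independent bound over `(0,τ]`.

References: H. Spohn, *Large Scale Dynamics of Interacting Particles* (1991), Part I §2.3, §3.3.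
-/

noncomputable section

namespace Summit.AtomisticToContinuum.HydrodynamicLimit.Theorems
namespace FluxClosureEq.E7

open scoped BigOperators Topology Classical MeasureTheory ProbabilityTheory InnerProductSpace ENNReal
open Filter Set Function MeasureTheory ProbabilityTheory
open Literature.MathematicalPhysics.KineticTheory Literature.Analysis.FluidPDE Literature.Analysis.FunctionSpaces

/-- `ofReal |∫ f| ≤ ∫⁻ ofReal |f|` for every real integrand (junk-safe: no integrability needed). [folklore] -/
theorem E7_ofReal_abs_integral_le {α : Type*} [MeasurableSpace α] (μ : Measure α) (f : α → ℝ) :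
    ENNReal.ofReal |∫ a, f a ∂μ| ≤ ∫⁻ a, ENNReal.ofReal |f a| ∂μ := by
  have h := norm_integral_le_lintegral_norm (μ := μ) f
  rw [Real.norm_eq_abs] at h
  calc ENNReal.ofReal |∫ a, f a ∂μ| ≤ ENNReal.ofReal ((∫⁻ a, ENNReal.ofReal ‖f a‖ ∂μ).toReal) :=
        ENNReal.ofReal_le_ofReal h
    _ ≤ ∫⁻ a, ENNReal.ofReal ‖f a‖ ∂μ := ENNReal.ofReal_toReal_le
    _ = ∫⁻ a, ENNReal.ofReal |f a| ∂μ := by simp_rw [Real.norm_eq_abs]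

/-- **A.e.-measurability on `phase space × time` with explicit time dependence.** For a hard-sphere flow `Ψ` on
`𝕋³`, a jointly measurable `g : ℝ × phase space → ℝ≥0∞`, a law `μ` carried by the good set and an s-finite `ν`
on `ℝ`, `(z, t) ↦ g (t, Ψ_t z)` is `μ ⊗ ν`-a.e. measurable (the flow is jointly measurable on `good × ℝ`,
`HardSphereFlow.measurable_flow_prod_torus`; modify off the good set). [folklore] -/
theorem E7_aemeasurable_comp_flow_prod {n : ℕ} {ε : ℝ} (Ψ : HardSphereFlow (Torus.geometry (Fin 3)) ε n)
    {g : ℝ × Config n (Fin 3) T3 → ℝ≥0∞} (hg : Measurable g) {μ : Measure (Config n (Fin 3) T3)}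
    (hμ : μ Ψ.goodᶜ = 0) (ν : Measure ℝ) [SFinite ν] :
    AEMeasurable (uncurry fun (z : Config n (Fin 3) T3) (t : ℝ) => g (t, Ψ.flow t z)) (μ.prod ν) := by
  set s : Set (Config n (Fin 3) T3 × ℝ) := Prod.fst ⁻¹' Ψ.good with hs_def
  have hs : MeasurableSet s := measurable_fst Ψ.measurableSet_good
  have h1 : Measurable fun p : s => ((⟨p.1.1, p.2⟩ : Ψ.good), p.1.2) :=
    (measurable_subtype_coe.fst.subtype_mk).prodMk measurable_subtype_coe.snd
  have hf : Measurable fun p : s => g (p.1.2, Ψ.flow p.1.2 p.1.1) :=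
    hg.comp (measurable_subtype_coe.snd.prodMk (Ψ.measurable_flow_prod_torus.comp h1))
  refine ⟨fun p => if hp : p ∈ s then g (p.2, Ψ.flow p.2 p.1) else 0, ?_, ?_⟩
  · exact Measurable.dite (f := fun p : s => g (p.1.2, Ψ.flow p.1.2 p.1.1)) hf (g := fun _ => 0)
      measurable_const hs
  · have hae : ∀ᵐ p ∂(μ.prod ν), p ∈ s := by
      rw [ae_iff]
      have e : {p : Config n (Fin 3) T3 × ℝ | ¬p ∈ s} = Ψ.goodᶜ ×ˢ (univ : Set ℝ) := by
        ext p; simp [hs_def]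
      rw [e, Measure.prod_prod, hμ, zero_mul]
    filter_upwards [hae] with p hp
    simp only [uncurry, dif_pos hp]

/-- **Kinetic isotropy in global equilibrium (rung 0 of stub K; registered sub-goal E7).** For `0 < σ ≤ 1/2`,
constants `a, θ > 0`, `u`, every horizon `T`, EVERY hard-sphere flow family `Φ` and every window `0 < ℓ_N ≤ 1` with
`(N+1)ℓ_N³ → ∞`: for `τ ∈ [0,T)` and `w` smooth on `[0,T) × 𝕋³`, the kinetic deviation functional of the crux
(`KinDev_N`, the traceless box velocity covariance tested against `∇w`, integrated over `(0,τ] × 𝕋³`) tends to `0`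
in `L¹` of the homogeneous local Gibbs law `localGibbsLaw σ a u θ`. This is exactly the conclusion of the open
stub `stub_kineticIsotropy` restricted to constant profiles (where its Euler-solution / LLN hypotheses are idle).
Proof: see the module docstring (stationarity + Gaussian statics + Tonelli). -/
theorem kineticIsotropy_homogeneous : ∀ (σ a θ : ℝ) (u : V3), 0 < σ → σ ≤ 1 / 2 → 0 < a → 0 < θ → ∀ (T : ℝ) (Φ : (N : ℕ) → HardSphereFlow (Torus.geometry (Fin 3)) (hsDiameter σ N) (N + 1)) (ℓ : ℕ → ℝ), (∀ N, 0 < ℓ N ∧ ℓ N ≤ 1) → Tendsto (fun N : ℕ => ℓ N ^ 3 * ((N : ℝ) + 1)) atTop atTop → let K := fun (l : ℝ) (x y : T3) => indicator {y' : T3 | ∀ i, ‖y' i - x i‖ < l / 2} (fun _ => (l ^ 3)⁻¹) y; let Dn := fun N t z x => empiricalDensityField ((Φ N).flow t z) (K (ℓ N) x); let Mm := fun N t z x => empiricalMomentumField ((Φ N).flow t z) (K (ℓ N) x); let En := fun N t z x => empiricalEnergyField ((Φ N).flow t z) (K (ℓ N) x); let Sk := fun N t z x (i j : Fin 3) =>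 ∫ y, K (ℓ N) x y.1 * (y.2 i * y.2 j) ∂(empiricalMeasure ((Φ N).flow t z)); let Th := fun (r : ℝ) (m : V3) (E : ℝ) => 2 / 3 * (E / r - ‖m‖ ^ 2 / (2 * r ^ 2)); ∀ τ ∈ Ico 0 T, ∀ w : ℝ → T3 → V3, Torus.IsSmoothSpaceTimeOn (Ico 0 T) w → Tendsto (fun N : ℕ => ∫⁻ z, ENNReal.ofReal (|∫ t in Ioc 0 τ, ∫ x, ∑ i, ∑ j, (Sk N t z x i j - Mm N t z x i * Mm N t z x j / Dn N t z x - (if i = j then Dn N t z x * Th (Dn N t z x) (Mm N t z x) (En N t z x) else 0)) * Torus.partialDeriv j (fun y => w t y i) x|) ∂(localGibbsLaw σ (fun _ => a) (fun _ => u) (fun _ => θ) N (Φ N))) atTop (𝓝 0) := by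
  intro σ a θ u _hσ hσ2 ha hθ T Φ ℓ hℓ hℓ3
  dsimp only
  intro τ hτ w hw
  -- uniform bound on `∇w` over `[0, τ] × 𝕋³`, and a clamp of the time axis into the slab
  obtain ⟨Cw, hCw0, hCw⟩ := FluxClosureK.exists_forall_abs_partialDeriv_le_slab hτ.2 hw
  obtain ⟨ρc, hρc, hρS, hρeq⟩ := FluxClosureB5.exists_clamp hτ
  obtain ⟨M₄, hM₄⟩ : ∃ M : ℝ, M = ∫ v, ‖v‖ ^ 4 ∂stdGaussian V3 := ⟨_, rfl⟩
  -- the `t`-independent static bound at level `N`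
  set b : ℕ → ℝ≥0∞ := fun N => ENNReal.ofReal (Cw * (18 * Real.sqrt ((((N + 1 : ℕ) : ℝ))⁻¹ * (ℓ N ^ 3)⁻¹ *
    (θ ^ 2 * M₄)) + 36 * ((((N + 1 : ℕ) : ℝ))⁻¹ * (ℓ N ^ 3)⁻¹ * θ))) with hb
  -- it tends to zero at a kinetic window
  have hr : Tendsto (fun N : ℕ => (((N + 1 : ℕ) : ℝ))⁻¹ * (ℓ N ^ 3)⁻¹) atTop (𝓝 0) := by
    refine (hℓ3.inv_tendsto_atTop).congr fun N => ?_
    rw [Pi.inv_apply, mul_inv, mul_comm]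
    push_cast
    ring
  have hφc : Continuous fun r : ℝ => Cw * (18 * Real.sqrt (r * (θ ^ 2 * M₄)) + 36 * (r * θ)) :=
    continuous_const.mul ((continuous_const.mul (Real.continuous_sqrt.comp (continuous_id.mul continuous_const))).add
      (continuous_const.mul (continuous_id.mul continuous_const)))
  have hφ : Tendsto (fun r : ℝ => Cw * (18 * Real.sqrt (r * (θ ^ 2 * M₄)) + 36 * (r * θ))) (𝓝 0) (𝓝 0) := by
    simpa using hφc.tendsto 0
  have hb0 : Tendsto b atTop (𝓝 0) := by
    have h := ENNReal.tendsto_ofReal (hφ.comp hr)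
    rw [ENNReal.ofReal_zero] at h
    exact h
  have hlim : Tendsto (fun N => ENNReal.ofReal τ * b N) atTop (𝓝 0) := by
    simpa using ENNReal.Tendsto.const_mul hb0 (Or.inr ENNReal.ofReal_ne_top)
  refine tendsto_of_tendsto_of_tendsto_of_le_of_le tendsto_const_nhds hlim (fun N => zero_le) fun N => ?_
  -- FIX `N`. Abstract the integrand: `S (c, x) i j`, the clamped test factor `G' (s, x) i j`.
  obtain ⟨S, hS⟩ : ∃ S : Config (N + 1) (Fin 3) T3 × T3 → Fin 3 → Fin 3 → ℝ, ∀ p i j, S p i j =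
      (∫ y, {y' : T3 | ∀ i, ‖y' i - p.2 i‖ < ℓ N / 2}.indicator (fun _ => (ℓ N ^ 3)⁻¹) y.1 * (y.2 i * y.2 j) ∂(empiricalMeasure p.1)) -
        empiricalMomentumField p.1 ({y' : T3 | ∀ i, ‖y' i - p.2 i‖ < ℓ N / 2}.indicator (fun _ => (ℓ N ^ 3)⁻¹)) i *
          empiricalMomentumField p.1 ({y' : T3 | ∀ i, ‖y' i - p.2 i‖ < ℓ N / 2}.indicator (fun _ => (ℓ N ^ 3)⁻¹)) j /
          empiricalDensityField p.1 ({y' : T3 | ∀ i, ‖y' i - p.2 i‖ < ℓ N / 2}.indicator (fun _ => (ℓ N ^ 3)⁻¹)) -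
        (if i = j then empiricalDensityField p.1 ({y' : T3 | ∀ i, ‖y' i - p.2 i‖ < ℓ N / 2}.indicator (fun _ => (ℓ N ^ 3)⁻¹)) *
          (2 / 3 * (empiricalEnergyField p.1 ({y' : T3 | ∀ i, ‖y' i - p.2 i‖ < ℓ N / 2}.indicator (fun _ => (ℓ N ^ 3)⁻¹)) /
              empiricalDensityField p.1 ({y' : T3 | ∀ i, ‖y' i - p.2 i‖ < ℓ N / 2}.indicator (fun _ => (ℓ N ^ 3)⁻¹)) -
            ‖empiricalMomentumField p.1 ({y' : T3 | ∀ i, ‖y' i - p.2 i‖ < ℓ N / 2}.indicator (fun _ => (ℓ N ^ 3)⁻¹))‖ ^ 2 /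
              (2 * empiricalDensityField p.1 ({y' : T3 | ∀ i, ‖y' i - p.2 i‖ < ℓ N / 2}.indicator (fun _ => (ℓ N ^ 3)⁻¹)) ^ 2)))
        else 0) := ⟨_, fun _ _ _ => rfl⟩
  have hk : Measurable fun p : T3 × T3 => {y' : T3 | ∀ i, ‖y' i - p.1 i‖ < ℓ N / 2}.indicator (fun _ => (ℓ N ^ 3)⁻¹) p.2 :=
    LGFS.measurable_boxK_uncurry (ℓ N)
  have hSm : ∀ i j, Measurable fun p : Config (N + 1) (Fin 3) T3 × T3 => S p i j := by
    intro i j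
    simp only [hS]
    exact FluxClosureB5.measurable_kinDevIntegrand
      (K := fun x y => {y' : T3 | ∀ i, ‖y' i - x i‖ < ℓ N / 2}.indicator (fun _ => (ℓ N ^ 3)⁻¹) y) hk i j
  obtain ⟨G', hG'⟩ : ∃ G' : ℝ × T3 → Fin 3 → Fin 3 → ℝ, ∀ q i j, G' q i j =
      Torus.partialDeriv j (fun y => w (ρc q.1) y i) q.2 := ⟨_, fun _ _ _ => rfl⟩
  have hG'm : ∀ i j, Measurable fun q : ℝ × T3 => G' q i j := by
    intro i j
    simp only [hG']
    exact FluxClosureB5.measurable_partialDeriv_comp_clamp hw (uniqueDiffOn_Ico 0 T) hρc hρS i j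
  have hG'eq : ∀ t ∈ Ioc 0 τ, ∀ x i j, G' (t, x) i j = Torus.partialDeriv j (fun y => w t y i) x := by
    intro t ht x i j
    rw [hG', hρeq t ht]
  have hG'b : ∀ t ∈ Ioc 0 τ, ∀ x i j, |G' (t, x) i j| ≤ Cw := by
    intro t ht x i j
    rw [hG'eq t ht]
    exact hCw t ⟨ht.1.le, ht.2⟩ i j x
  -- the jointly measurable integrand and its `x`-integral
  have hF : Measurable fun q : (ℝ × Config (N + 1) (Fin 3) T3) × T3 => ∑ i, ∑ j, S (q.1.2, q.2) i j * G' (q.1.1, q.2) i j := by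
    refine Finset.measurable_sum _ fun i _ => Finset.measurable_sum _ fun j _ => ?_
    exact ((hSm i j).comp (measurable_fst.snd.prodMk measurable_snd)).mul
      ((hG'm i j).comp (measurable_fst.fst.prodMk measurable_snd))
  obtain ⟨H, hH⟩ : ∃ H : ℝ × Config (N + 1) (Fin 3) T3 → ℝ≥0∞, ∀ p, H p =
      ENNReal.ofReal |∫ x, ∑ i, ∑ j, S (p.2, x) i j * G' (p.1, x) i j| := ⟨_, fun _ => rfl⟩
  have hHm : Measurable H := by
    have h1 : StronglyMeasurable fun p : ℝ × Config (N + 1) (Fin 3) T3 => ∫ x, ∑ i, ∑ j, S (p.2, x) i j * G' (p.1, x) i j :=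
      hF.stronglyMeasurable.integral_prod_right'
    have h2 : Measurable fun p : ℝ × Config (N + 1) (Fin 3) T3 =>
        ENNReal.ofReal |∫ x, ∑ i, ∑ j, S (p.2, x) i j * G' (p.1, x) i j| :=
      (continuous_abs.measurable.comp h1.measurable).ennreal_ofReal
    have e : H = fun p : ℝ × Config (N + 1) (Fin 3) T3 =>
        ENNReal.ofReal |∫ x, ∑ i, ∑ j, S (p.2, x) i j * G' (p.1, x) i j| := funext hH
    rw [e]
    exact h2
  -- the law: probability, carried by the good set, stationary
  set P : Measure (Config (N + 1) (Fin 3) T3) := localGibbsLaw σ (fun _ => a) (fun _ => u) (fun _ => θ) N (Φ N) with hP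
  haveI : IsProbabilityMeasure P :=
    isProbabilityMeasure_localGibbsLaw continuous_const continuous_const continuous_const (fun _ => ha)
      (fun _ => hθ) hσ2 N (Φ N)
  have hPgood : P (Φ N).goodᶜ = 0 := by
    have hac : P ≪ liouville (Torus.geometry (Fin 3)) (N + 1) (hsDiameter σ N) := by
      rw [hP, localGibbsLaw, particleLaw_eq]
      exact withDensity_absolutelyContinuous _ _
    exact hac (Φ N).measure_compl_good
  -- (A) pointwise in `z`: `ofReal |∫ₜ ∫ₓ| ≤ ∫⁻ₜ H (t, Φ_t z)` (clamp on `(0, τ]`, junk-safe)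
  have hA : ∀ z, ENNReal.ofReal |∫ t in Ioc 0 τ, ∫ x, ∑ i, ∑ j, S ((Φ N).flow t z, x) i j *
      Torus.partialDeriv j (fun y => w t y i) x| ≤ ∫⁻ t in Ioc 0 τ, H (t, (Φ N).flow t z) := by
    intro z
    have heq : (∫ t in Ioc 0 τ, ∫ x, ∑ i, ∑ j, S ((Φ N).flow t z, x) i j * Torus.partialDeriv j (fun y => w t y i) x) =
        ∫ t in Ioc 0 τ, ∫ x, ∑ i, ∑ j, S ((Φ N).flow t z, x) i j * G' (t, x) i j := by
      refine setIntegral_congr_fun measurableSet_Ioc fun t ht => ?_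
      simp only [hG'eq t ht]
    rw [heq]
    simp only [hH]
    exact E7_ofReal_abs_integral_le _ _
  -- (B) Tonelli on `P ⊗ dt|_(0,τ]`
  have hB : ∫⁻ z, (∫⁻ t in Ioc 0 τ, H (t, (Φ N).flow t z)) ∂P = ∫⁻ t in Ioc 0 τ, (∫⁻ z, H (t, (Φ N).flow t z) ∂P) :=
    lintegral_lintegral_swap (E7_aemeasurable_comp_flow_prod (Φ N) hHm hPgood (volume.restrict (Ioc 0 τ)))
  -- (C) at each time in `(0, τ]`: stationarity, then the Gaussian statics of the traceless covariance
  have hC : ∀ t ∈ Ioc 0 τ, ∫⁻ z, H (t, (Φ N).flow t z) ∂P ≤ b N := by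
    intro t ht
    have hHt : Measurable fun c : Config (N + 1) (Fin 3) T3 => H (t, c) :=
      hHm.comp (measurable_const.prodMk measurable_id)
    have hstat : ∫⁻ z, H (t, (Φ N).flow t z) ∂P = ∫⁻ z, H (t, z) ∂P :=
      (measurePreserving_flow_localGibbsLaw_const σ a θ u N (Φ N) t).lintegral_comp hHt
    rw [hstat, hP, localGibbsLaw_eq]
    have key := FluxClosureEq.E6.kinStatic_lintegral_localGibbs_le (u := u) hσ2 ha hθ N
      (K := fun x y => {y' : T3 | ∀ i, ‖y' i - x i‖ < ℓ N / 2}.indicator (fun _ => (ℓ N ^ 3)⁻¹) y)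
      (CK := (ℓ N ^ 3)⁻¹) hk (fun x y => LGFS.boxK_nonneg (hℓ N).1.le x y)
      (fun x y => LGFS.boxK_le (hℓ N).1.le x y) (fun q => FluxClosureK.integral_boxK_left (hℓ N).1 (hℓ N).2 q)
      (G := fun x i j => G' (t, x) i j) (B := Cw) (fun x i j => hG'b t ht x i j)
    simp only [hH, hS]
    rw [← hM₄] at key
    exact key
  -- (D) integrate the `t`-independent bound over `(0, τ]`
  have hD : ∫⁻ t in Ioc 0 τ, (∫⁻ z, H (t, (Φ N).flow t z) ∂P) ≤ ENNReal.ofReal τ * b N := by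
    have hae : ∀ᵐ t ∂(volume.restrict (Ioc 0 τ)), (∫⁻ z, H (t, (Φ N).flow t z) ∂P) ≤ b N :=
      (ae_restrict_iff' measurableSet_Ioc).2 (ae_of_all _ fun t ht => hC t ht)
    calc ∫⁻ t in Ioc 0 τ, (∫⁻ z, H (t, (Φ N).flow t z) ∂P)
        ≤ ∫⁻ _t in Ioc 0 τ, b N := lintegral_mono_ae hae
      _ = b N * volume (Ioc 0 τ) := setLIntegral_const _ _
      _ = ENNReal.ofReal τ * b N := by rw [Real.volume_Ioc, sub_zero, mul_comm]
  -- assemble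
  have hgoal : ∫⁻ z, ENNReal.ofReal |∫ t in Ioc 0 τ, ∫ x, ∑ i, ∑ j, S ((Φ N).flow t z, x) i j *
      Torus.partialDeriv j (fun y => w t y i) x| ∂P ≤ ENNReal.ofReal τ * b N :=
    calc ∫⁻ z, ENNReal.ofReal |∫ t in Ioc 0 τ, ∫ x, ∑ i, ∑ j, S ((Φ N).flow t z, x) i j *
          Torus.partialDeriv j (fun y => w t y i) x| ∂P
        ≤ ∫⁻ z, (∫⁻ t in Ioc 0 τ, H (t, (Φ N).flow t z)) ∂P := lintegral_mono fun z => hA z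
      _ = ∫⁻ t in Ioc 0 τ, (∫⁻ z, H (t, (Φ N).flow t z) ∂P) := hB
      _ ≤ ENNReal.ofReal τ * b N := hD
  simpa only [hS] using hgoal

end FluxClosureEq.E7
end Summit.AtomisticToContinuum.HydrodynamicLimit.Theorems

end
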